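import Mathlib.Analysis.SpecialFunctions.Pow.Real
import Mathlib.Analysis.SpecialFunctions.Log.Base
import Mathlib.Analysis.Complex.ExponentialBounds
import HarnessLib

/-!
# Barrier `NPHardnessToOneWayFunctions` (AGGM 2006, Thm. 4): adequacy of the parameters — numerics

App. D campaign (design v3), bridge part B5-i, of the discharge of
`Literature.Barriers.PneNP.AkaviaEtAl2006_complMemAM` (Akavia–Goldreich–Goldwasser–Moshkovitz,
STOC 2006; held preprint, PDF page = printed page + 1).

The protocol's parameters are chosen as explicit polynomials of ONE size parameter: with
`X = 2^a > κ F (n+2)` (`n` the input length, `F` the number of slots, `κ = log₂(|C| F)`) put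
`T = 2^64 X^4` and take `P = T` thresholds, `m = T^5` runs, `M = 64 T^6` pool positions (one in
`64` planted), claim precision `c = T^3`, tolerances `1/T²`, fuzz masses `1/(4096 X²)`, `T^3`
tolerated exceptions, `T^8` basic lower-bound tests, secret-test accuracy `1/T²` with mean bucket
`T^{11}`. This file proves the real-number inequalities this choice must satisfy — every term
of the soundness error `errS` and of the completeness error `errC` is at most `2^{-9}`-ish, and the
side conditions (`12 (v + FL) ≤ m`, the fuzz widths, …) hold — in CLOSED FORM over real variables
`T, X, F, n, κ`; `…Adequacy.lean` instantiates them. Mathlib only; all proved, no named facts.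

## References

* [AkaviaEtAl2006] A. Akavia, O. Goldreich, S. Goldwasser, D. Moshkovitz, *On basing one-way
  functions on NP-hardness*, STOC 2006; preprint App. D (printed pp. 21–22).
-/

noncomputable section

namespace Literature.Barriers.PneNP

namespace AppD

namespace Adq

/-! ### Two analytic inequalities -/

/-- **Geometric decay**: `(1-ρ)^k ≤ 1/(1 + k ρ)` for `ρ ∈ [0,1]` (Bernoulli). [folklore] -/
theorem one_sub_pow_le {ρ : ℝ} (h0 : 0 ≤ ρ) (h1 : ρ ≤ 1) (k : ℕ) : (1 - ρ) ^ k ≤ 1 / (1 + k * ρ) := by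
  have hB : 1 + (k : ℝ) * ρ ≤ (1 + ρ) ^ k := one_add_mul_le_pow (by linarith) k
  have hpos : 0 < 1 + (k : ℝ) * ρ := by positivity
  rw [le_div_iff₀ hpos]
  calc (1 - ρ) ^ k * (1 + k * ρ) ≤ (1 - ρ) ^ k * (1 + ρ) ^ k :=
        mul_le_mul_of_nonneg_left hB (pow_nonneg (by linarith) k)
    _ = (1 - ρ ^ 2) ^ k := by rw [← mul_pow]; ring_nf
    _ ≤ 1 := pow_le_one₀ (by nlinarith) (by nlinarith)

/-- `log₂ (1+β)³ ≤ 3β / ln 2`. [folklore] -/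
theorem logb_cube_le {β : ℝ} (hβ : 0 ≤ β) : Real.logb 2 ((1 + β) ^ 3) ≤ 3 * β / Real.log 2 := by
  have hl2 : 0 < Real.log 2 := Real.log_pos one_lt_two
  unfold Real.logb
  rw [Real.log_pow, div_le_div_iff_of_pos_right hl2]
  have := Real.log_le_sub_one_of_pos (show 0 < 1 + β by linarith)
  push_cast
  linarith

/-- `0 ≤ log₂ (1+β)³`. [folklore] -/
theorem logb_cube_nonneg {β : ℝ} (hβ : 0 ≤ β) : 0 ≤ Real.logb 2 ((1 + β) ^ 3) :=
  Real.logb_nonneg one_lt_two (one_le_pow₀ (by linarith))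

/-- `2^{2/c} ≤ 2` for `c ≥ 2`. [folklore] -/
theorem two_rpow_two_div_le {c : ℝ} (hc : 2 ≤ c) : (2 : ℝ) ^ ((2 : ℝ) / c) ≤ 2 := by
  have h : (2 : ℝ) / c ≤ 1 := by rw [div_le_one (by linarith)]; exact hc
  simpa using Real.rpow_le_rpow_of_exponent_le one_le_two h

/-! ### The size parameters -/

section Sizes

variable {T X F n κ : ℝ}

/-- The standing hypotheses on the sizes: `X ≥ 4`, `T = 2^64 X^4`, `F ≥ 1`, `n ≥ 0`, `κ ≥ 1`,
`κ F (n+2) ≤ X`. [folklore] -/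
structure Hyp (T X F n κ : ℝ) : Prop where
  hX : 4 ≤ X
  hT : T = 2 ^ 64 * X ^ 4
  hF : 1 ≤ F
  hn : 0 ≤ n
  hκ : 1 ≤ κ
  hb : κ * F * (n + 2) ≤ X

namespace Hyp

variable (h : Hyp T X F n κ)
include h

/-- `F ≤ X`. [folklore] -/
theorem F_le_X : F ≤ X := by
  have := h.hb; have := h.hκ; have := h.hn; have := h.hF; nlinarith [mul_nonneg (by linarith : (0:ℝ) ≤ κ - 1) (by linarith : (0:ℝ) ≤ F)]

/-- `κ ≤ X`. [folklore] -/
theorem κ_le_X : κ ≤ X := by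
  have := h.hb; have := h.hκ; have := h.hn; have := h.hF
  nlinarith [mul_nonneg (by linarith : (0:ℝ) ≤ κ) (by nlinarith : (0:ℝ) ≤ F * (n + 2) - 1)]

/-- `n + 2 ≤ X`. [folklore] -/
theorem n_le_X : n + 2 ≤ X := by
  have := h.hb; have := h.hκ; have := h.hn; have := h.hF
  nlinarith [mul_nonneg (by nlinarith : (0:ℝ) ≤ κ * F - 1) (by linarith : (0:ℝ) ≤ n + 2)]

/-- `F (n+2) ≤ X`. [folklore] -/
theorem Fn_le_X : F * (n + 2) ≤ X := by
  have := h.hb; have := h.hκ; have := h.hn; have := h.hF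
  nlinarith [mul_nonneg (by linarith : (0:ℝ) ≤ κ - 1) (by nlinarith : (0:ℝ) ≤ F * (n + 2))]

/-- `κ F ≤ X`. [folklore] -/
theorem Fκ_le_X : κ * F ≤ X := by
  have := h.hb; have := h.hκ; have := h.hn; have := h.hF
  nlinarith [mul_nonneg (by nlinarith : (0:ℝ) ≤ κ * F) (by linarith : (0:ℝ) ≤ n + 1)]

/-- `X > 0`. [folklore] -/
theorem X_pos : 0 < X := by linarith [h.hX]

/-- `T > 0`. [folklore] -/
theorem T_pos : 0 < T := by rw [h.hT]; have := h.hX; positivity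

/-- `T ≥ 2^70 X`. [folklore] -/
theorem X_le_T : 2 ^ 70 * X ≤ T := by
  rw [h.hT]; have := h.hX
  nlinarith [pow_le_pow_left₀ (by norm_num : (0:ℝ) ≤ 4) this 3, sq_nonneg X, mul_pos (by norm_num : (0:ℝ) < 2 ^ 64) (by positivity : (0:ℝ) < X)]

/-- `T ≥ 2^72`. [folklore] -/
theorem T_ge : (2 : ℝ) ^ 72 ≤ T := by have := h.X_le_T; have := h.hX; nlinarith

/-- `T ≥ 1`. [folklore] -/
theorem one_le_T : 1 ≤ T := le_trans (by norm_num) h.T_ge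

/-- `X² ≤ T / 2^68`. [folklore] -/
theorem X_sq_le_T : 2 ^ 68 * X ^ 2 ≤ T := by
  rw [h.hT]; have := h.hX
  nlinarith [pow_le_pow_left₀ (by norm_num : (0:ℝ) ≤ 4) this 2, sq_nonneg X, mul_pos (by norm_num : (0:ℝ) < 2 ^ 64) (by positivity : (0:ℝ) < X ^ 2)]

/-! ### Elementary smallness facts -/

/-- `1/T ≤ 2⁻⁷²`. [folklore] -/
theorem inv_T_le : 1 / T ≤ 1 / 2 ^ 72 :=
  one_div_le_one_div_of_le (by positivity) h.T_ge

/-- `X²/T ≤ 2⁻⁶⁸`. [folklore] -/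
theorem X_sq_div_T_le : X ^ 2 / T ≤ 1 / 2 ^ 68 := by
  have := h.X_sq_le_T; have := h.T_pos
  rw [div_le_div_iff₀ (by positivity) (by positivity)]; linarith

/-- `X/T ≤ 2⁻⁷⁰`. [folklore] -/
theorem X_div_T_le : X / T ≤ 1 / 2 ^ 70 := by
  have := h.X_le_T; have := h.T_pos
  rw [div_le_div_iff₀ (by positivity) (by positivity)]; linarith

/-- `κ²/T ≤ 2⁻⁶⁸`. [folklore] -/
theorem κ_sq_div_T_le : κ ^ 2 / T ≤ 1 / 2 ^ 68 := by
  have h1 := h.κ_le_X; have := h.hκ; have := h.T_pos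
  calc κ ^ 2 / T ≤ X ^ 2 / T := by gcongr
    _ ≤ _ := h.X_sq_div_T_le

/-- `n²/T ≤ 2⁻⁶⁸`. [folklore] -/
theorem n_sq_div_T_le : n ^ 2 / T ≤ 1 / 2 ^ 68 := by
  have h1 := h.n_le_X; have := h.hn; have := h.T_pos
  calc n ^ 2 / T ≤ X ^ 2 / T := by gcongr; linarith
    _ ≤ _ := h.X_sq_div_T_le

/-- `F/T ≤ 2⁻⁷⁰`. [folklore] -/
theorem F_div_T_le : F / T ≤ 1 / 2 ^ 70 := by
  have h1 := h.F_le_X; have := h.T_pos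
  calc F / T ≤ X / T := by gcongr
    _ ≤ _ := h.X_div_T_le

/-- `F n /(4096 X²) ≤ 2⁻¹⁴`. [folklore] -/
theorem Fn_ζ_le : F * n / (4096 * X ^ 2) ≤ 1 / 2 ^ 14 := by
  have h1 := h.Fn_le_X; have := h.hX; have := h.hn; have := h.hF
  rw [div_le_div_iff₀ (by positivity) (by positivity)]
  nlinarith [mul_nonneg (by linarith : (0:ℝ) ≤ F) (by linarith : (0:ℝ) ≤ n)]

/-! ### The lower-bound and secret tests -/

/-- **Lower-bound test errors**: `(mF + M)(64/u + 64/u) ≤ 2⁻⁴⁰` with `u = T⁸`. [folklore] -/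
theorem gs_err_le : (T ^ 5 * F + 64 * T ^ 6) * (64 / T ^ 8 + 64 / T ^ 8) ≤ 1 / 2 ^ 40 := by
  have hT := h.T_pos; have h1 := h.F_le_X; have h2 := h.X_le_T; have h3 := h.T_ge; have := h.hF
  have hF' : F ≤ T := by nlinarith
  calc (T ^ 5 * F + 64 * T ^ 6) * (64 / T ^ 8 + 64 / T ^ 8) ≤ (T ^ 6 + 64 * T ^ 6) * (128 / T ^ 8) := by
        rw [← add_div, show (64 : ℝ) + 64 = 128 by norm_num]
        gcongr
        nlinarith [pow_pos hT 5]
    _ = 65 * 128 / T ^ 2 := by field_simp; ring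
    _ ≤ _ := by rw [div_le_div_iff₀ (by positivity) (by positivity)]; nlinarith

/-- **The secret test's false-rejection rate is at most one half**: `32/(β²(1+β) 2^{b₀}) ≤ 1/2`
with `β = 1/T²`, `2^{b₀} = T¹¹`. [folklore] -/
theorem fr_le_half : 32 / ((1 / T ^ 2) ^ 2 * (1 + 1 / T ^ 2) * T ^ 11) ≤ 1 / 2 := by
  have hT := h.T_pos; have h3 := h.T_ge
  rw [div_le_div_iff₀ (by positivity) (by positivity)]
  have : (1 / T ^ 2) ^ 2 * (1 + 1 / T ^ 2) * T ^ 11 ≥ T ^ 7 := by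
    have e : (1 / T ^ 2) ^ 2 * (1 + 1 / T ^ 2) * T ^ 11 = T ^ 7 + T ^ 5 := by field_simp
    rw [e]; nlinarith [pow_pos hT 5]
  nlinarith [pow_le_pow_left₀ (by norm_num : (0:ℝ) ≤ 2 ^ 72) h3 7]

omit h in
/-- **The secret test's detection rate**: `ρ = β(1-fr)/(1+β) ≥ β/4` when `fr ≤ 1/2`, `β ≤ 1`. [folklore] -/
theorem rho_ge {β fr : ℝ} (hβ : 0 ≤ β) (hβ1 : β ≤ 1) (hfr : fr ≤ 1 / 2) : β / 4 ≤ β * (1 - fr) / (1 + β) := by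
  rw [div_le_div_iff₀ (by norm_num) (by linarith)]; nlinarith

/-- **Few under-claimed plants survive**: `(1-ρ)^{k} ≤ 2⁻⁶⁹` for `ρ ≥ 1/(4T²)` and `k ≥ T³`. [folklore] -/
theorem surv_le {ρ : ℝ} (hρ : 1 / (4 * T ^ 2) ≤ ρ) (hρ1 : ρ ≤ 1) {k : ℕ} (hk : T ^ 3 ≤ k) :
    (1 - ρ) ^ k ≤ 1 / 2 ^ 69 := by
  have hT := h.T_pos; have h3 := h.T_ge
  have h0 : 0 ≤ ρ := le_trans (by positivity) hρ
  refine (one_sub_pow_le h0 hρ1 k).trans ?_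
  have hkρ : T / 4 ≤ k * ρ := by
    calc T / 4 = T ^ 3 * (1 / (4 * T ^ 2)) := by field_simp
      _ ≤ k * ρ := mul_le_mul hk hρ (by positivity) (by positivity)
  calc 1 / (1 + k * ρ) ≤ 1 / (T / 4) := one_div_le_one_div_of_le (by positivity) (by linarith)
    _ = 4 / T := by field_simp
    _ ≤ _ := by rw [div_le_div_iff₀ hT (by positivity)]; nlinarith

omit h in
/-- **The hiding factor**: `1 - ρ K/(K + γ t) ≤ 1 - ρ/2` when `γ t ≤ K`, `K > 0`. [folklore] -/
theorem hide_le {ρ K γ t : ℝ} (hρ : 0 ≤ ρ) (hK : 0 < K) (hγt : γ * t ≤ K) (hγ : 0 ≤ γ * t) :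
    1 - ρ * (K / (K + γ * t)) ≤ 1 - ρ / 2 := by
  have : 1 / 2 ≤ K / (K + γ * t) := by
    rw [div_le_div_iff₀ (by norm_num) (by linarith)]; nlinarith
  nlinarith [mul_le_mul_of_nonneg_left this hρ]

/-- **Few hidden decoys survive**: `(1 - ρ/2)^k ≤ 2⁻⁶⁸` for `ρ ≥ 1/(4T²)`, `k ≥ T³`. [folklore] -/
theorem hsurv_le {ρ : ℝ} (hρ : 1 / (4 * T ^ 2) ≤ ρ) (hρ1 : ρ ≤ 1) {k : ℕ} (hk : T ^ 3 ≤ k) :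
    (1 - ρ / 2) ^ k ≤ 1 / 2 ^ 68 := by
  have hT := h.T_pos; have h3 := h.T_ge
  have h0 : 0 ≤ ρ := le_trans (by positivity) hρ
  refine (one_sub_pow_le (by positivity) (by linarith) k).trans ?_
  have hkρ : T / 8 ≤ k * (ρ / 2) := by
    calc T / 8 = T ^ 3 * (1 / (4 * T ^ 2) / 2) := by field_simp; ring
      _ ≤ k * (ρ / 2) := mul_le_mul hk (by linarith) (by positivity) (by positivity)
  calc 1 / (1 + k * (ρ / 2)) ≤ 1 / (T / 8) := one_div_le_one_div_of_le (by positivity) (by linarith)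
    _ = 8 / T := by field_simp
    _ ≤ _ := by rw [div_le_div_iff₀ hT (by positivity)]; nlinarith

omit h in
/-- `γ₀ t_max ≤ 63`: `γ₀ = 2^{2/c} (1+β)³ ≤ 2 (1 + 1/16)³` and `t_max ≤ 16`. [folklore] -/
theorem γt_le {c β t : ℝ} (hc : 2 ≤ c) (hβ : 0 ≤ β) (hβ1 : β ≤ 1 / 16) (ht0 : 0 ≤ t) (ht : t ≤ 16) :
    (2 : ℝ) ^ ((2 : ℝ) / c) * (1 + β) ^ 3 * t ≤ 63 := by
  have h1 := two_rpow_two_div_le hc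
  have h2 : (1 + β) ^ 3 ≤ (1 + 1 / 16) ^ 3 := by gcongr
  have h0 : (0 : ℝ) ≤ (2 : ℝ) ^ ((2 : ℝ) / c) := by positivity
  calc (2 : ℝ) ^ ((2 : ℝ) / c) * (1 + β) ^ 3 * t ≤ 2 * (1 + 1 / 16) ^ 3 * 16 := by
        gcongr
    _ ≤ 63 := by norm_num

/-- The largest threshold exponent: `3 + 1/T² ≤ 4`. [folklore] -/
theorem texp_le : (3 : ℝ) + 1 / T ^ 2 ≤ 4 := by
  have hT := h.one_le_T
  have : 1 / T ^ 2 ≤ 1 := by rw [div_le_one (by positivity)]; nlinarith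
  linarith

/-! ### Sampling terms -/

/-- Runs, occurrence averages: `(Fκ)²/(4m(Fη/2)²) = κ²/T`. [folklore] -/
theorem samp_ru_κ : (F * κ) ^ 2 / (4 * T ^ 5 * (F * (1 / T ^ 2) / 2) ^ 2) ≤ 1 / 2 ^ 68 := by
  have hT := h.T_pos; have hF := h.hF
  rw [show (F * κ) ^ 2 / (4 * T ^ 5 * (F * (1 / T ^ 2) / 2) ^ 2) = κ ^ 2 / T by field_simp; ring]
  exact h.κ_sq_div_T_le

/-- Pool, occurrence averages: `κ²/(4M(η/(2·64))²) = 64κ²/T²`. [folklore] -/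
theorem samp_pl_κ : κ ^ 2 / (4 * (64 * T ^ 6) * (1 / T ^ 2 / (2 * 64)) ^ 2) ≤ 1 / 2 ^ 68 := by
  have hT := h.T_pos; have h1 := h.κ_sq_div_T_le; have h3 := h.T_ge; have := h.hκ
  rw [show κ ^ 2 / (4 * (64 * T ^ 6) * (1 / T ^ 2 / (2 * 64)) ^ 2) = 64 * κ ^ 2 / T ^ 2 by field_simp; ring]
  rw [div_le_div_iff₀ hT (by positivity)] at h1
  rw [div_le_div_iff₀ (by positivity) (by positivity)]
  nlinarith

/-- Pool, plant density: `1/(4M(1/64)²) = 16/T⁶`. [folklore] -/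
theorem samp_pu_one : (1 : ℝ) ^ 2 / (4 * (64 * T ^ 6) * (1 / 64) ^ 2) ≤ 1 / 2 ^ 68 := by
  have hT := h.T_pos; have h3 := h.T_ge
  rw [show (1 : ℝ) ^ 2 / (4 * (64 * T ^ 6) * (1 / 64) ^ 2) = 16 / T ^ 6 by field_simp; ring]
  rw [div_le_div_iff₀ (by positivity) (by positivity)]
  nlinarith [pow_le_pow_left₀ (by norm_num : (0:ℝ) ≤ 2 ^ 72) h3 6]

/-- Runs, unit-bounded statistics: `F²/(4m(Fη/2)²) = 1/T`. [folklore] -/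
theorem samp_ru_one : (F * 1) ^ 2 / (4 * T ^ 5 * (F * (1 / T ^ 2) / 2) ^ 2) ≤ 1 / 2 ^ 68 := by
  have hT := h.T_pos; have hF := h.hF; have h3 := h.T_ge
  rw [show (F * 1) ^ 2 / (4 * T ^ 5 * (F * (1 / T ^ 2) / 2) ^ 2) = 1 / T by field_simp; norm_num]
  exact h.inv_T_le.trans (by norm_num)

/-- Pool, unit-bounded statistics: `1/(4M(η/128)²) = 64/T²`. [folklore] -/
theorem samp_pl_one : (1 : ℝ) ^ 2 / (4 * (64 * T ^ 6) * (1 / T ^ 2 / (2 * 64)) ^ 2) ≤ 1 / 2 ^ 68 := by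
  have hT := h.T_pos; have h3 := h.T_ge
  rw [show (1 : ℝ) ^ 2 / (4 * (64 * T ^ 6) * (1 / T ^ 2 / (2 * 64)) ^ 2) = 64 / T ^ 2 by field_simp; ring]
  rw [div_le_div_iff₀ (by positivity) (by positivity)]
  nlinarith

/-- Runs, `n`-bounded statistics: `(Fn)²/(4m(Fη/2)²) = n²/T`. [folklore] -/
theorem samp_ru_n : (F * n) ^ 2 / (4 * T ^ 5 * (F * (1 / T ^ 2) / 2) ^ 2) ≤ 1 / 2 ^ 68 := by
  have hT := h.T_pos; have hF := h.hF
  rw [show (F * n) ^ 2 / (4 * T ^ 5 * (F * (1 / T ^ 2) / 2) ^ 2) = n ^ 2 / T by field_simp; ring]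
  exact h.n_sq_div_T_le

/-- Pool, `n`-bounded statistics: `n²/(4M(η/128)²) = 64n²/T²`. [folklore] -/
theorem samp_pl_n : n ^ 2 / (4 * (64 * T ^ 6) * (1 / T ^ 2 / (2 * 64)) ^ 2) ≤ 1 / 2 ^ 68 := by
  have hT := h.T_pos; have h1 := h.n_sq_div_T_le; have h3 := h.T_ge; have := h.hn
  rw [show n ^ 2 / (4 * (64 * T ^ 6) * (1 / T ^ 2 / (2 * 64)) ^ 2) = 64 * n ^ 2 / T ^ 2 by field_simp; ring]
  rw [div_le_div_iff₀ hT (by positivity)] at h1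
  rw [div_le_div_iff₀ (by positivity) (by positivity)]
  nlinarith

/-- Runs, fuzz counts: `F²/(4m(Fη)²) = 1/(4T)`. [folklore] -/
theorem samp_ru_fz : (F * 1) ^ 2 / (4 * T ^ 5 * (F * (1 / T ^ 2)) ^ 2) ≤ 1 / 2 ^ 68 := by
  have hT := h.T_pos; have hF := h.hF; have h3 := h.T_ge
  rw [show (F * 1) ^ 2 / (4 * T ^ 5 * (F * (1 / T ^ 2)) ^ 2) = 1 / (4 * T) by field_simp]
  rw [div_le_div_iff₀ (by positivity) (by positivity)]
  nlinarith

/-- Pool, fuzz counts: `1/(4M(η/64)²) = 16/T²`. [folklore] -/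
theorem samp_pu_fz : (1 : ℝ) ^ 2 / (4 * (64 * T ^ 6) * (1 / T ^ 2 / 64) ^ 2) ≤ 1 / 2 ^ 68 := by
  have hT := h.T_pos; have h3 := h.T_ge
  rw [show (1 : ℝ) ^ 2 / (4 * (64 * T ^ 6) * (1 / T ^ 2 / 64) ^ 2) = 16 / T ^ 2 by field_simp; ring]
  rw [div_le_div_iff₀ (by positivity) (by positivity)]
  nlinarith

/-- **Fuzz masses**: `1/(ζ P) = 4096 X²/T ≤ 2⁻⁵⁶`. [folklore] -/
theorem fuzz_mass_le : 1 / (1 / (4096 * X ^ 2) * T) ≤ 1 / 2 ^ 56 := by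
  have hT := h.T_pos; have hX := h.X_pos; have h1 := h.X_sq_div_T_le
  rw [show 1 / (1 / (4096 * X ^ 2) * T) = 4096 * (X ^ 2 / T) by field_simp]
  linarith

/-- **Bucket fluctuation**: `2 mF/(2^{lp} (η_h N)²) ≤ 2⁻⁶⁸`. [folklore] -/
theorem fluct_le : 2 * (T ^ 5 * F) / (T ^ 8 * (1 / T ^ 2 * (T ^ 5 * F)) ^ 2) ≤ 1 / 2 ^ 68 := by
  have hT := h.T_pos; have hF := h.hF; have h3 := h.T_ge
  rw [show 2 * (T ^ 5 * F) / (T ^ 8 * (1 / T ^ 2 * (T ^ 5 * F)) ^ 2) = 2 / (T ^ 9 * F) by field_simp]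
  rw [div_le_div_iff₀ (by positivity) (by positivity)]
  have h8 : (1:ℝ) ≤ T ^ 8 := one_le_pow₀ h.one_le_T
  have : (2:ℝ) ^ 72 ≤ T ^ 9 * F := by
    calc (2:ℝ) ^ 72 ≤ T := h3
      _ = T * 1 * 1 := by ring
      _ ≤ T * T ^ 8 * F := by gcongr
      _ = T ^ 9 * F := by ring
  nlinarith

/-- **Majority terms**: `36/m + mF ε₀ ≤ 2⁻⁶⁴` with `ε₀ = 2/2^{lp} + 2ⁿ/D`, `D = 2ⁿ T⁶`. [folklore] -/
theorem maj_le {Dn : ℝ} (hD : 0 < Dn) : 36 / T ^ 5 + T ^ 5 * F * (2 / T ^ 8 + Dn / (Dn * T ^ 6)) ≤ 1 / 2 ^ 64 := by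
  have hT := h.T_pos; have hF := h.hF; have h3 := h.T_ge; have h4 := h.F_div_T_le
  rw [show 36 / T ^ 5 + T ^ 5 * F * (2 / T ^ 8 + Dn / (Dn * T ^ 6)) = 36 / T ^ 5 + 2 * (F / T) / T ^ 2 + F / T by
    field_simp; ring]
  have e1 : 36 / T ^ 5 ≤ 36 / 2 ^ 72 := by
    apply div_le_div_of_nonneg_left (by norm_num) (by positivity)
    nlinarith [pow_le_pow_left₀ (by norm_num : (0:ℝ) ≤ 2 ^ 72) h3 5]
  have e2 : 2 * (F / T) / T ^ 2 ≤ 2 * (F / T) :=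
    div_le_self (by have := div_nonneg (by linarith : (0:ℝ) ≤ F) hT.le; positivity) (one_le_pow₀ h.one_le_T)
  linarith

/-- The majority slack over the robustness: `(mF 2ⁿ/D)/v ≤ 2⁻⁶⁶` with `v = m/13`. [folklore] -/
theorem maj_v_le {Dn : ℝ} (hD : 0 < Dn) : T ^ 5 * F * Dn / (Dn * T ^ 6) / (T ^ 5 / 13) ≤ 1 / 2 ^ 66 := by
  have hT := h.T_pos; have h4 := h.F_div_T_le
  rw [show T ^ 5 * F * Dn / (Dn * T ^ 6) / (T ^ 5 / 13) = 13 * (F / T) / T ^ 5 by field_simp]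
  rw [div_le_iff₀ (by positivity)]
  nlinarith [pow_le_pow_left₀ (by norm_num : (0:ℝ) ≤ 1) h.one_le_T 5, div_nonneg (by linarith [h.hF] : (0:ℝ) ≤ F) hT.le]

/-! ### Completeness-specific terms -/

/-- `T^k ≥ 2^72` for `k ≥ 1`. [folklore] -/
theorem le_T_pow {k : ℕ} (hk : k ≠ 0) : (2 : ℝ) ^ 72 ≤ T ^ k := h.T_ge.trans (le_self_pow₀ h.one_le_T hk)

/-- `1/T^j ≤ 1/T^i` for `i ≤ j`. [folklore] -/
theorem inv_pow_mono {i j : ℕ} (hij : i ≤ j) : 1 / T ^ j ≤ 1 / T ^ i :=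
  one_div_le_one_div_of_le (pow_pos h.T_pos i) (pow_le_pow_right₀ h.one_le_T hij)

/-- Low buckets: `mF · 2/(δ² 2^{lp}) = 162 F/T ≤ 2⁻⁶²` with `δ = 1/(9T)`. [folklore] -/
theorem lowq_le : T ^ 5 * F * (2 / ((1 / (9 * T)) ^ 2 * T ^ 8)) ≤ 1 / 2 ^ 62 := by
  have hT := h.T_pos; have h4 := h.F_div_T_le
  rw [show T ^ 5 * F * (2 / ((1 / (9 * T)) ^ 2 * T ^ 8)) = 162 * (F / T) by field_simp; ring]
  linarith

/-- Bad buckets: `mF · 4/2^{lp} ≤ 2⁻⁷⁰`. [folklore] -/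
theorem bbad_le : T ^ 5 * F * (4 / T ^ 8) ≤ 1 / 2 ^ 70 := by
  have hT := h.T_pos; have h4 := h.F_div_T_le; have h1 := h.one_le_T; have hF := h.hF
  rw [show T ^ 5 * F * (4 / T ^ 8) = 4 * (F / T) / T ^ 2 by field_simp]
  have h0 : 0 ≤ 4 * (F / T) := by have := div_nonneg (by linarith : (0:ℝ) ≤ F) hT.le; positivity
  calc 4 * (F / T) / T ^ 2 ≤ 4 * (F / T) / 2 ^ 2 := by
        apply div_le_div_of_nonneg_left h0 (by norm_num); nlinarith [h.T_ge]
    _ ≤ _ := by linarith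

/-- Secret-test false rejections: `M ε_A = 64 T⁶ · 2/(β² 2^{b₀}) = 128/T ≤ 2⁻⁶⁴`. [folklore] -/
theorem ah_err_le : 64 * T ^ 6 * (2 / ((1 / T ^ 2) ^ 2 * T ^ 11)) ≤ 1 / 2 ^ 64 := by
  have hT := h.T_pos; have h4 := h.inv_T_le
  rw [show 64 * T ^ 6 * (2 / ((1 / T ^ 2) ^ 2 * T ^ 11)) = 128 * (1 / T) by field_simp; norm_num]
  linarith

/-- Runs, preimage averages with `η_s = 1/(3T)`: `9n²/T³ ≤ 2⁻⁶⁸`. [folklore] -/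
theorem samp_ru_ns : (F * n) ^ 2 / (4 * T ^ 5 * (F * (1 / (3 * T)) / 2) ^ 2) ≤ 1 / 2 ^ 68 := by
  have hT := h.T_pos; have hF := h.hF; have h1 := h.n_sq_div_T_le; have := h.hn
  rw [show (F * n) ^ 2 / (4 * T ^ 5 * (F * (1 / (3 * T)) / 2) ^ 2) = 9 * (n ^ 2 / T) / T ^ 2 by field_simp; ring]
  have h0 : 0 ≤ 9 * (n ^ 2 / T) := by positivity
  calc 9 * (n ^ 2 / T) / T ^ 2 ≤ 9 * (n ^ 2 / T) / 2 ^ 4 := by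
        apply div_le_div_of_nonneg_left h0 (by norm_num); nlinarith [h.T_ge]
    _ ≤ _ := by linarith

/-- Pool, preimage averages with `η_s = 1/(3T)`: `576 n²/T⁴ ≤ 2⁻⁶⁸`. [folklore] -/
theorem samp_pl_ns : n ^ 2 / (4 * (64 * T ^ 6) * (1 / (3 * T) / (2 * 64)) ^ 2) ≤ 1 / 2 ^ 68 := by
  have hT := h.T_pos; have h1 := h.n_sq_div_T_le; have := h.hn
  rw [show n ^ 2 / (4 * (64 * T ^ 6) * (1 / (3 * T) / (2 * 64)) ^ 2) = 576 * (n ^ 2 / T) / T ^ 3 by field_simp; ring]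
  have h0 : 0 ≤ 576 * (n ^ 2 / T) := by positivity
  have h3 : (2:ℝ) ^ 10 ≤ T ^ 3 := le_trans (by norm_num) (h.le_T_pow (k := 3) (by norm_num))
  calc 576 * (n ^ 2 / T) / T ^ 3 ≤ 576 * (n ^ 2 / T) / 2 ^ 10 := div_le_div_of_nonneg_left h0 (by norm_num) h3
    _ ≤ _ := by linarith

/-! ### Side conditions -/

/-- `log₂ KS ≤ 5/T²` for `KS = (1 + 1/T²)³`. [folklore] -/
theorem logKS_le : Real.logb 2 ((1 + 1 / T ^ 2) ^ 3) ≤ 5 / T ^ 2 := by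
  have hT := h.T_pos
  refine (logb_cube_le (by positivity)).trans ?_
  have hl : (0.6931471803 : ℝ) < Real.log 2 := Real.log_two_gt_d9
  have hl0 : 0 < Real.log 2 := by linarith
  calc 3 * (1 / T ^ 2) / Real.log 2 = (3 / Real.log 2) * (1 / T ^ 2) := by ring
    _ ≤ 5 * (1 / T ^ 2) := by
        gcongr
        rw [div_le_iff₀ hl0]; nlinarith
    _ = 5 / T ^ 2 := by ring

/-- `log₂ KS ≥ 0`. [folklore] -/
theorem logKS_nonneg : 0 ≤ Real.logb 2 ((1 + 1 / T ^ 2) ^ 3) := by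
  have hT := h.T_pos; exact logb_cube_nonneg (by positivity)

/-- Fuzz width, runs: `d + 1/c ≤ w_f`. [folklore] -/
theorem hwf : 1 / (2 * T) + 1 / T ^ 3 ≤ 1 / T := by
  have hT := h.T_pos; have h2 := h.T_ge
  have e1 : 1 / T ^ 3 ≤ 1 / (2 * T) := by
    apply one_div_le_one_div_of_le (by positivity); nlinarith [pow_pos hT 2]
  have e2 : 1 / (2 * T) + 1 / (2 * T) = 1 / T := by field_simp; norm_num
  linarith

/-- Fuzz width, plants: `2/c + log₂ KS_S ≤ w_f'`. [folklore] -/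
theorem hwf' : 2 / T ^ 3 + Real.logb 2 ((1 + 1 / T ^ 2) ^ 3) ≤ 1 / T := by
  have hT := h.T_pos; have h2 := h.T_ge; have hl := h.logKS_le
  have e1 : 2 / T ^ 3 ≤ 2 / T ^ 2 := div_le_div_of_nonneg_left (by norm_num) (by positivity) (pow_le_pow_right₀ h.one_le_T (by norm_num))
  have e2 : 7 / T ^ 2 ≤ 1 / T := by rw [div_le_div_iff₀ (by positivity) hT]; nlinarith
  have e3 : 2 / T ^ 2 + 5 / T ^ 2 = 7 / T ^ 2 := by ring
  linarith

/-- The grid is coarser than the fuzz: `2 w_f c < g`. [folklore] -/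
theorem hw : 2 * (1 / T) * T ^ 3 < 2 * T ^ 2 + 1 := by
  have hT := h.T_pos
  rw [show 2 * (1 / T) * T ^ 3 = 2 * T ^ 2 by field_simp]; linarith

/-- Completeness grid condition: `2 (1/c) c < g`. [folklore] -/
theorem hg : 2 * (1 / T ^ 3) * T ^ 3 < 2 * T ^ 2 + 1 := by
  have hT := h.T_pos
  rw [show 2 * (1 / T ^ 3) * T ^ 3 = 2 by field_simp]; nlinarith [h.one_le_T]

/-- Completeness occurrence tolerance: `η₁ + 1/c ≤ η_C`. [folklore] -/
theorem hηC : 1 / T ^ 2 + 1 / T ^ 3 ≤ 2 / T ^ 2 := by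
  have := h.inv_pow_mono (show 2 ≤ 3 by norm_num)
  have e : 2 / T ^ 2 = 1 / T ^ 2 + 1 / T ^ 2 := by ring
  linarith

/-- Completeness preimage tolerance: `η_s + 1/c' + 3δ ≤ η_T`. [folklore] -/
theorem hηT : 1 / (3 * T) + 1 / (3 * T) + 3 * (1 / (9 * T)) ≤ 1 / T := by
  have hT := h.T_pos
  rw [show 1 / (3 * T) + 1 / (3 * T) + 3 * (1 / (9 * T)) = 1 / T by field_simp; norm_num]

/-- Completeness flip budget: `12 N (ζ + η_F) ≤ m`. [folklore] -/
theorem hfl : 12 * (T ^ 5 * F * (1 / (4096 * X ^ 2) + 1 / T ^ 2)) ≤ T ^ 5 := by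
  have hT := h.T_pos; have hX := h.X_pos; have h1 := h.F_le_X; have h2 := h.hX; have h3 := h.X_le_T; have hF := h.hF
  have e1 : F * (1 / (4096 * X ^ 2)) ≤ 1 / 48 := by
    rw [mul_one_div, div_le_div_iff₀ (by positivity) (by norm_num)]; nlinarith
  have e2 : F * (1 / T ^ 2) ≤ 1 / 48 := by
    rw [mul_one_div, div_le_div_iff₀ (by positivity) (by norm_num)]; nlinarith
  nlinarith [pow_pos hT 5]

/-- The secret tests' mean bucket: `64/β² ≤ 2^{b₀}`. [folklore] -/
theorem hB₀ : 64 / (1 / T ^ 2) ^ 2 ≤ T ^ 11 := by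
  have hT := h.T_pos; have h2 := h.T_ge; have h1 := h.one_le_T
  rw [show 64 / (1 / T ^ 2) ^ 2 = 64 * T ^ 4 by field_simp]
  calc 64 * T ^ 4 ≤ T * T ^ 4 := by gcongr; linarith
    _ = T ^ 5 := by ring
    _ ≤ T ^ 11 := pow_le_pow_right₀ h1 (by norm_num)

/-! ### The omission budget and the flip budget -/

/-- **The deficiency budget per run**: `DEF/N ≤ 34/T`. [folklore] -/
theorem def_div_le {L : ℝ} (_hL0 : 0 ≤ L) (hL : L ≤ 5 / T ^ 2) :
    (1 / T ^ 2 + 3 / T ^ 3 + 2 * L + T ^ 3 * κ / T ^ 6 + 2 / T ^ 2) / (1 / (2 * T)) ≤ 34 / T := by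
  have hT := h.T_pos; have h2 := h.T_ge; have hκ := h.κ_le_X; have hX := h.X_le_T; have hκ1 := h.hκ
  have hb : 0 < 1 / T ^ 2 := by positivity
  have e3 : 3 / T ^ 3 ≤ 3 * (1 / T ^ 2) := by
    rw [show 3 * (1 / T ^ 2) = 3 / T ^ 2 by ring]
    exact div_le_div_of_nonneg_left (by norm_num) (by positivity) (pow_le_pow_right₀ h.one_le_T (by norm_num))
  have eκ : T ^ 3 * κ / T ^ 6 ≤ 1 / T ^ 2 := by
    rw [div_le_iff₀ (by positivity), show 1 / T ^ 2 * T ^ 6 = T ^ 3 * T by field_simp]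
    exact mul_le_mul_of_nonneg_left (by linarith) (by positivity)
  have e2 : 2 / T ^ 2 = 2 * (1 / T ^ 2) := by ring
  have e5 : 5 / T ^ 2 = 5 * (1 / T ^ 2) := by ring
  have hsum : 1 / T ^ 2 + 3 / T ^ 3 + 2 * L + T ^ 3 * κ / T ^ 6 + 2 / T ^ 2 ≤ 17 * (1 / T ^ 2) := by linarith
  calc (1 / T ^ 2 + 3 / T ^ 3 + 2 * L + T ^ 3 * κ / T ^ 6 + 2 / T ^ 2) / (1 / (2 * T))
        ≤ 17 * (1 / T ^ 2) / (1 / (2 * T)) := by gcongr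
    _ = 34 / T := by field_simp; ring

/-- **The omission bracket is small**: `PHI/(ln 2 · N) ≤ 37 n/T + 2 ζ n + 2/T`. [folklore] -/
theorem inner_le {LC LS : ℝ} (hLC0 : 0 ≤ LC) (hLC : LC ≤ 5 / T ^ 2) (hLS : LS ≤ 5 / T ^ 2) :
    1 / T ^ 2 +
      (T ^ 5 * F * (1 / T ^ 2 + 3 / T ^ 3 + 2 * LC + T ^ 3 * κ / T ^ 6 + 2 / T ^ 2) / (1 / (2 * T)) +
          T ^ 5 * F * (1 / (4096 * X ^ 2) + 1 / T ^ 2)) * n / (T ^ 5 * F) +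
      1 / T ^ 2 / Real.log 2 +
      (2 * T ^ 3 + T ^ 3 + T ^ 6 * (1 / (4096 * X ^ 2) + 1 / T ^ 2)) * n / T ^ 6 +
      2 * (1 / T ^ 3 + LS) + 1 / T ≤
      37 * (1 / T) * n + 2 * (1 / (4096 * X ^ 2)) * n + 2 * (1 / T) := by
  have hT := h.T_pos; have h2 := h.T_ge; have hF := h.hF; have hn := h.hn; have hX := h.X_pos
  have hl0 : 0 < Real.log 2 := Real.log_pos one_lt_two
  have hdef := h.def_div_le hLC0 hLC
  have eD : T ^ 5 * F * (1 / T ^ 2 + 3 / T ^ 3 + 2 * LC + T ^ 3 * κ / T ^ 6 + 2 / T ^ 2) / (1 / (2 * T)) =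
      T ^ 5 * F * ((1 / T ^ 2 + 3 / T ^ 3 + 2 * LC + T ^ 3 * κ / T ^ 6 + 2 / T ^ 2) / (1 / (2 * T))) := mul_div_assoc _ _ _
  have eA : (T ^ 5 * F * ((1 / T ^ 2 + 3 / T ^ 3 + 2 * LC + T ^ 3 * κ / T ^ 6 + 2 / T ^ 2) / (1 / (2 * T))) +
          T ^ 5 * F * (1 / (4096 * X ^ 2) + 1 / T ^ 2)) * n / (T ^ 5 * F) =
      ((1 / T ^ 2 + 3 / T ^ 3 + 2 * LC + T ^ 3 * κ / T ^ 6 + 2 / T ^ 2) / (1 / (2 * T)) + (1 / (4096 * X ^ 2) + 1 / T ^ 2)) * n := by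
    field_simp
  have eB : (2 * T ^ 3 + T ^ 3 + T ^ 6 * (1 / (4096 * X ^ 2) + 1 / T ^ 2)) * n / T ^ 6 = (3 / T ^ 3 + (1 / (4096 * X ^ 2) + 1 / T ^ 2)) * n := by
    field_simp; ring
  rw [eD, eA, eB]
  have hab : 16 * (1 / T ^ 2) ≤ 1 / T := by
    rw [mul_one_div, div_le_div_iff₀ (by positivity) hT]; nlinarith
  have hbc : 1 / T ^ 3 ≤ 1 / T ^ 2 := h.inv_pow_mono (by norm_num)
  have hb0 : 0 < 1 / T ^ 2 := by positivity
  have e3c : 3 / T ^ 3 = 3 * (1 / T ^ 3) := by ring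
  have e34 : 34 / T = 34 * (1 / T) := by ring
  have e5 : 5 / T ^ 2 = 5 * (1 / T ^ 2) := by ring
  have il : 1 / T ^ 2 / Real.log 2 ≤ 2 * (1 / T ^ 2) := by
    rw [div_le_iff₀ hl0]
    have := mul_le_mul_of_nonneg_left Real.log_two_gt_d9.le hb0.le
    nlinarith
  have hζ0 : 0 ≤ 1 / (4096 * X ^ 2) := by positivity
  have i1 : ((1 / T ^ 2 + 3 / T ^ 3 + 2 * LC + T ^ 3 * κ / T ^ 6 + 2 / T ^ 2) / (1 / (2 * T)) + (1 / (4096 * X ^ 2) + 1 / T ^ 2)) * n ≤ (35 * (1 / T) + 1 / (4096 * X ^ 2)) * n := by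
    apply mul_le_mul_of_nonneg_right _ hn; linarith
  have i2 : (3 / T ^ 3 + (1 / (4096 * X ^ 2) + 1 / T ^ 2)) * n ≤ (2 * (1 / T) + 1 / (4096 * X ^ 2)) * n := by
    apply mul_le_mul_of_nonneg_right _ hn; linarith
  nlinarith

/-- **The omission budget over the robustness is small**: `PHI / v ≤ 1/400`. [folklore] -/
theorem phi_v_le {LC LS : ℝ} (hLC0 : 0 ≤ LC) (hLC : LC ≤ 5 / T ^ 2) (hLS0 : 0 ≤ LS) (hLS : LS ≤ 5 / T ^ 2) :
    Real.log 2 * (T ^ 5 * F * (1 / T ^ 2 +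
      (T ^ 5 * F * (1 / T ^ 2 + 3 / T ^ 3 + 2 * LC + T ^ 3 * κ / T ^ 6 + 2 / T ^ 2) / (1 / (2 * T)) +
          T ^ 5 * F * (1 / (4096 * X ^ 2) + 1 / T ^ 2)) * n / (T ^ 5 * F) +
      1 / T ^ 2 / Real.log 2 +
      (2 * T ^ 3 + T ^ 3 + T ^ 6 * (1 / (4096 * X ^ 2) + 1 / T ^ 2)) * n / T ^ 6 +
      2 * (1 / T ^ 3 + LS) + 1 / T)) / (T ^ 5 / 13) ≤ 1 / 400 := by
  have hT := h.T_pos; have hF := h.hF; have hn := h.hn; have hX := h.X_pos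
  have hκ0 : 0 ≤ κ := by linarith [h.hκ]
  have hl : Real.log 2 < 0.6931471808 := Real.log_two_lt_d9
  have hl0 : 0 < Real.log 2 := Real.log_pos one_lt_two
  have hin := h.inner_le hLC0 hLC hLS
  have hF0 : (0 : ℝ) ≤ F := by linarith
  have key0 := mul_le_mul_of_nonneg_left hin hF0
  -- F · (bound) is small
  have hFn := h.Fn_le_X; have hXT := h.X_div_T_le; have hFζ := h.Fn_ζ_le
  have j1 : F * (37 * (1 / T) * n + 2 * (1 / T)) ≤ 37 * (X / T) := by
    rw [show F * (37 * (1 / T) * n + 2 * (1 / T)) = (37 * (F * n) + 2 * F) / T by field_simp,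
      show 37 * (X / T) = 37 * X / T by ring]
    apply div_le_div_of_nonneg_right _ hT.le; nlinarith
  have j2 : F * (2 * (1 / (4096 * X ^ 2)) * n) = 2 * (F * n / (4096 * X ^ 2)) := by field_simp
  have j3 : F * (37 * (1 / T) * n + 2 * (1 / (4096 * X ^ 2)) * n + 2 * (1 / T)) ≤ 1 / 2 ^ 12 := by
    have : F * (37 * (1 / T) * n + 2 * (1 / (4096 * X ^ 2)) * n + 2 * (1 / T)) =
        F * (37 * (1 / T) * n + 2 * (1 / T)) + F * (2 * (1 / (4096 * X ^ 2)) * n) := by ring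
    rw [this, j2]; linarith
  have key := key0.trans j3
  have e : ∀ x : ℝ, Real.log 2 * (T ^ 5 * F * x) / (T ^ 5 / 13) = 13 * Real.log 2 * (F * x) := fun x => by
    field_simp
  rw [e]
  have hI0 : 0 ≤ F * (1 / T ^ 2 +
      (T ^ 5 * F * (1 / T ^ 2 + 3 / T ^ 3 + 2 * LC + T ^ 3 * κ / T ^ 6 + 2 / T ^ 2) / (1 / (2 * T)) +
          T ^ 5 * F * (1 / (4096 * X ^ 2) + 1 / T ^ 2)) * n / (T ^ 5 * F) +
      1 / T ^ 2 / Real.log 2 +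
      (2 * T ^ 3 + T ^ 3 + T ^ 6 * (1 / (4096 * X ^ 2) + 1 / T ^ 2)) * n / T ^ 6 +
      2 * (1 / T ^ 3 + LS) + 1 / T) := by positivity
  nlinarith [mul_le_mul hl.le key hI0 (by norm_num)]

/-- **The flip budget fits**: `12 (v + FL) ≤ m`. [folklore] -/
theorem hvfl {LC : ℝ} (hLC0 : 0 ≤ LC) (hLC : LC ≤ 5 / T ^ 2) :
    12 * (T ^ 5 / 13 + (T ^ 5 * F * (1 / T ^ 2 + 1 / T ^ 2 + (T ^ 3 + T ^ 6 * (1 / (4096 * X ^ 2) + 1 / T ^ 2)) / T ^ 6) +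
      2 * (T ^ 5 * F * (1 / T ^ 2 + 3 / T ^ 3 + 2 * LC + T ^ 3 * κ / T ^ 6 + 2 / T ^ 2) / (1 / (2 * T))) +
      2 * (T ^ 5 * F * (1 / (4096 * X ^ 2) + 1 / T ^ 2)))) ≤ T ^ 5 := by
  have hT := h.T_pos; have h2 := h.T_ge; have hF := h.hF; have hX := h.X_pos
  have hdef := h.def_div_le hLC0 hLC
  have h1 := h.F_le_X; have hXX := h.hX; have hXT := h.X_le_T
  have eD : T ^ 5 * F * (1 / T ^ 2 + 3 / T ^ 3 + 2 * LC + T ^ 3 * κ / T ^ 6 + 2 / T ^ 2) / (1 / (2 * T)) =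
      T ^ 5 * F * ((1 / T ^ 2 + 3 / T ^ 3 + 2 * LC + T ^ 3 * κ / T ^ 6 + 2 / T ^ 2) / (1 / (2 * T))) := by
    rw [mul_div_assoc]
  rw [eD]
  set D := (1 / T ^ 2 + 3 / T ^ 3 + 2 * LC + T ^ 3 * κ / T ^ 6 + 2 / T ^ 2) / (1 / (2 * T)) with hD
  set ζ : ℝ := 1 / (4096 * X ^ 2) with hζ
  have hζ0 : 0 ≤ ζ := by positivity
  have e2 : (T ^ 3 + T ^ 6 * (ζ + 1 / T ^ 2)) / T ^ 6 = 1 / T ^ 3 + (ζ + 1 / T ^ 2) := by field_simp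
  rw [e2]
  have hab : 16 * (1 / T ^ 2) ≤ 1 / T := by
    rw [mul_one_div, div_le_div_iff₀ (by positivity) hT]; nlinarith
  have hbc : 1 / T ^ 3 ≤ 1 / T ^ 2 := h.inv_pow_mono (by norm_num)
  have hb0 : 0 < 1 / T ^ 2 := by positivity
  have e27 : 34 / T = 34 * (1 / T) := by ring
  have hin : 1 / T ^ 2 + 1 / T ^ 2 + (1 / T ^ 3 + (ζ + 1 / T ^ 2)) + 2 * D + 2 * (ζ + 1 / T ^ 2) ≤ 69 * (1 / T) + 3 * ζ := by
    linarith
  have eFL : T ^ 5 * F * (1 / T ^ 2 + 1 / T ^ 2 + (1 / T ^ 3 + (ζ + 1 / T ^ 2))) + 2 * (T ^ 5 * F * D) +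
      2 * (T ^ 5 * F * (ζ + 1 / T ^ 2)) =
      T ^ 5 * (F * (1 / T ^ 2 + 1 / T ^ 2 + (1 / T ^ 3 + (ζ + 1 / T ^ 2)) + 2 * D + 2 * (ζ + 1 / T ^ 2))) := by ring
  have hsm : F * (69 * (1 / T) + 3 * ζ) ≤ 1 / 156 := by
    have j1 : F * (69 * (1 / T)) ≤ 69 * (X / T) := by
      rw [show F * (69 * (1 / T)) = 69 * F / T by field_simp, show 69 * (X / T) = 69 * X / T by ring]
      apply div_le_div_of_nonneg_right _ hT.le; nlinarith
    have j2 : F * (3 * ζ) ≤ 3 / (4096 * 4) := by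
      rw [hζ, show F * (3 * (1 / (4096 * X ^ 2))) = 3 * F / (4096 * X ^ 2) by ring,
        div_le_div_iff₀ (by positivity) (by norm_num)]
      nlinarith
    have := h.X_div_T_le
    rw [mul_add]; linarith
  have hF0 : (0:ℝ) ≤ F := by linarith
  have hFin : F * (1 / T ^ 2 + 1 / T ^ 2 + (1 / T ^ 3 + (ζ + 1 / T ^ 2)) + 2 * D + 2 * (ζ + 1 / T ^ 2)) ≤ 1 / 156 :=
    (mul_le_mul_of_nonneg_left hin hF0).trans hsm
  rw [eFL]
  nlinarith [pow_pos hT 5]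

end Hyp

end Sizes

end Adq

end AppD

end Literature.Barriers.PneNP

end
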